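import Summits.Ventures.QEC.Census.LRATLeavesBBX
import Summits.Ventures.QEC.Census.BB.BB72KBRank
import Summits.Ventures.QEC.Census.BB.BB72KBCover
import HarnessLib

/-!
# `[[72,12,6]]` by KERNEL B, `X` side: every `X`-logical of `BB.bb72` has weight `≥ 6`

Cell `qec`, route `BB72DistanceCertificate` (supporting evidence; the route's lower-bound item is the
`Z`-side statement, closed).  The `X ↔ Z` exchange of
`Theorems/BB72DistanceCertificateNoZLogicalBelowSixKernelB.lean`: qec-search-2's kernel-B certificate
2329a660016ec77c, `X` side (72 leaf CNFs `Q_any(H_Z, LZ, 5) ++ pins` and 2 completeness CNFs, CaDiCaL LRAT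
refutations replayed in the kernel by `KRup`: `Census/BB/BB72KBLeavesX*.lean`, `BB72KBCover.lean`, emitter
qec-search-10), the completeness of the certificate's `Z`-logical basis (`BB72KBRank.hlogX_bb72`), and the
`X`-side assembly `BB.Code.le_hammingNorm_xLogical_of_kernelB_pinned` (`Census/LRATLeavesBBX.lean`; pin by
type-12's `exists_xLogical_pinned`).  For `QC(A,B)` `d^X = d^Z` (Lemma 1), so this is a THIRD kernel
derivation of the distance lower bound, through a disjoint set of 72 solver proofs.  Tier KERNEL.
-/

namespace Summit.Ventures.QEC.Census.BB72KB

open Matrix Literature.InformationTheory.QuantumCodes Summit.Ventures.QEC.Census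
open Summit.Ventures.QEC.Census.LRATBridge

/-- **No `X`-logical of `BB.bb72` below weight 6, by kernel B**: every `v` with `H^Z v = 0`, `v ∉ rs H^X`
(`Mono ⊕ Mono` indexing) has Hamming weight `≥ 6`. -/
theorem bb72_noXLogicalBelowSix_kernelB : ∀ v : BB.Mono 6 6 ⊕ BB.Mono 6 6 → ZMod 2,
    BB.bb72.css.HZ *ᵥ v = 0 → v ∉ BB.bb72.css.rowSpX → 6 ≤ hammingNorm v :=
  BB.bb72.le_hammingNorm_xLogical_of_kernelB_pinned (d := 6) lzVec hlogX_bb72 HZ LZ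
    rowSupports_bb72_HZFlat supports_lzVec cubesX0 cubesX1 leavesX0 leavesX1 coverX0_unsat coverX1_unsat
    cubesX0_lt cubesX1_lt

/-- Hence `6 ≤ d^X(BB.bb72.css)` by kernel B (existence of an `X`-logical as the guard hypothesis). -/
theorem bb72_six_le_dX_kernelB
    (hex : ∃ v : BB.Mono 6 6 ⊕ BB.Mono 6 6 → ZMod 2, BB.bb72.css.HZ *ᵥ v = 0 ∧ v ∉ BB.bb72.css.rowSpX) :
    6 ≤ BB.bb72.css.dX :=
  BB.bb72.css.le_dX hex bb72_noXLogicalBelowSix_kernelB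

end Summit.Ventures.QEC.Census.BB72KB
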